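import Literature.MathematicalPhysics.QuantumManyBody.GroundStateFeynmanKacProofs
import Literature.MathematicalPhysics.QuantumManyBody.PeriodicFeynmanKacTrialState
import HarnessLib

/-!
# Symmetric `C¹` Dirichlet trial states uniformly close to a continuous eigenfunction candidate

Helper for item `GroundStateAccessible` (stmt-AtomisticToContinuum-12069) of route `BECInsertionVariance`
(`Summit.AtomisticToContinuum.BoseEinsteinCondensation.Theses.BECInsertionVariance.GroundStateAccessible`),
on the way to "the Feynman–Kac ground state of a BOUNDED pair potential is a ground state of the
closed Dirichlet form" (`BECInsertionVarianceGroundStateAccessibleFKGroundState.lean`).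

The tree's `groundStateEnergy_le_ofReal_of_eigen` (`GroundStateFeynmanKacProofs.lean`, Part III;
Chung–Zhao (1995) Prop 3.29, upper half) builds, for a continuous nonnegative symmetric normalised
`Ψ₀` vanishing off the box with `e^{-λt} ≤ ⟨Ψ₀, e^{-tH_N}Ψ₀⟩`, symmetric `C¹` Dirichlet trial states of
energy `≤ λ + ε`, but only records the energy inequality. Here the SAME construction
(`trialFn L θ Ψ₀`, dilate-and-mollify, normalised) is re-run keeping the second piece of
information the construction yields: the trial state is UNIFORMLY `ε`-close to `Ψ₀`
(`exists_trialState_near`). Both facts together make `Ψ₀` an `L²`-limit of trial states with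
energies `→ λ`, i.e. a minimiser of the closed form when `λ = E₀`.

The short private lemmas of Part III that the construction uses (energy of a real-scaled trial
state, real form of the potential term) are inlined in the proof; the box estimate
`‖∫ (φ² − Ψ₀²) w‖ ≤ B·vol·2M·s` is `norm_integral_sq_sub_sq_mul_le`; `ennnorm_sq_ofReal_periodic` and
`realKinetic_const_mul_periodic` are the public twins in `PeriodicFeynmanKacTrialState.lean`.
(`BECCutLineWeakDisorderWitnessTransferTrial.lean` replays the same construction for another route,
exposing `θ` and `c² ≤ 1 + ε` instead of the uniform closeness.)
-/

noncomputable section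

open MeasureTheory Filter Set
open scoped ENNReal NNReal Topology

namespace Summit.AtomisticToContinuum.BoseEinsteinCondensation.Theorems.BECInsertionVariance

open Literature.MathematicalPhysics.QuantumManyBody.BoseGas

variable {N : ℕ}

/-! ### The box estimate -/

/-- Mass of a difference of squares against a bounded weight on the box:
`‖∫ (φ² - Ψ₀²) w‖ ≤ B · vol(Λ) · 2M · s` when `sup|φ - Ψ₀| ≤ s`, `|φ|, |Ψ₀| ≤ M`, `‖w‖ ≤ B`, and both
functions vanish off the box. [folklore] -/
theorem norm_integral_sq_sub_sq_mul_le {L : ℝ} {φ Ψ₀ w : Config N → ℝ}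
    {M s B : ℝ} (hM0 : 0 ≤ M) (hs0 : 0 ≤ s) (hφM : ∀ X, |φ X| ≤ M) (hΨM : ∀ X, |Ψ₀ X| ≤ M)
    (hw : ∀ X, ‖w X‖ ≤ B)
    (hφ0 : ∀ X, X ∉ boxN N L → φ X = 0) (hΨ0 : ∀ X, X ∉ boxN N L → Ψ₀ X = 0)
    (hsup : ∀ X, |φ X - Ψ₀ X| ≤ s) :
    ‖∫ X, (φ X ^ 2 - Ψ₀ X ^ 2) * w X‖ ≤ B * (volume (boxN N L)).toReal * (2 * M) * s := by
  have hpt : ∀ X, ‖(φ X ^ 2 - Ψ₀ X ^ 2) * w X‖ ≤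
      (boxN N L).indicator (fun _ => B * (2 * M) * s) X := by
    intro X
    by_cases hX : X ∈ boxN N L
    · rw [Set.indicator_of_mem hX, norm_mul, Real.norm_eq_abs,
        show φ X ^ 2 - Ψ₀ X ^ 2 = (φ X - Ψ₀ X) * (φ X + Ψ₀ X) by ring, abs_mul]
      calc |φ X - Ψ₀ X| * |φ X + Ψ₀ X| * ‖w X‖ ≤ s * (M + M) * B := by
            refine mul_le_mul (mul_le_mul (hsup X)
              ((abs_add_le _ _).trans (add_le_add (hφM X) (hΨM X))) (abs_nonneg _) hs0) (hw X)
              (norm_nonneg _) (by positivity)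
        _ = B * (2 * M) * s := by ring
    · rw [Set.indicator_of_notMem hX, hφ0 X hX, hΨ0 X hX]; simp
  have hint : Integrable ((boxN N L).indicator fun _ : Config N => B * (2 * M) * s) volume := by
    refine IntegrableOn.integrable_indicator ?_ (measurableSet_boxN N L)
    exact integrableOn_const (volume_boxN_lt_top N L).ne
  calc ‖∫ X, (φ X ^ 2 - Ψ₀ X ^ 2) * w X‖
      ≤ ∫ X, (boxN N L).indicator (fun _ => B * (2 * M) * s) X :=
        norm_integral_le_of_norm_le hint (Eventually.of_forall hpt)
    _ = B * (volume (boxN N L)).toReal * (2 * M) * s := by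
        rw [integral_indicator_const _ (measurableSet_boxN N L), smul_eq_mul, measureReal_def]
        ring

/-! ### An elementary estimate for the normalising constant -/

/-- Elementary: if `|n - 1| ≤ τ ≤ 1/4` then `|(√n)⁻¹ - 1| ≤ 2τ`. [folklore] -/
theorem abs_inv_sqrt_sub_one_le {n τ : ℝ} (hn : |n - 1| ≤ τ) (hτ : τ ≤ 1 / 4) :
    |(Real.sqrt n)⁻¹ - 1| ≤ 2 * τ := by
  have hτ0 : 0 ≤ τ := (abs_nonneg _).trans hn
  have hn34 : 3 / 4 ≤ n := by have := (abs_le.1 hn).1; linarith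
  have hn0 : 0 < n := by linarith
  set r := Real.sqrt n with hr
  have hrpos : 0 < r := Real.sqrt_pos.2 hn0
  have hr2 : r ^ 2 = n := Real.sq_sqrt hn0.le
  have hrhalf : 1 / 2 ≤ r := by
    by_contra h
    push Not at h
    nlinarith [hrpos]
  have h1 : |1 - r| * (1 + r) = |n - 1| := by
    rw [← abs_of_pos (by linarith : (0 : ℝ) < 1 + r), ← abs_mul, ← hr2]
    rw [show (1 - r) * (1 + r) = -(r ^ 2 - 1) by ring, abs_neg]
  have h2 : |1 - r| ≤ τ := by
    have : |1 - r| ≤ |1 - r| * (1 + r) := le_mul_of_one_le_right (abs_nonneg _) (by linarith)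
    linarith [h1 ▸ this]
  have h3 : (Real.sqrt n)⁻¹ - 1 = (1 - r) / r := by
    rw [← hr]; field_simp
  rw [h3, abs_div, abs_of_pos hrpos, div_le_iff₀ hrpos]
  nlinarith [abs_nonneg (1 - r)]

/-! ### The trial states -/

/-- **Symmetric `C¹` Dirichlet trial states, `ε`-good in energy AND uniformly `ε`-close.** For
`L > 0`, a measurable pair potential `v ≤ C`, and a continuous, nonnegative, permutation-symmetric
`Ψ₀` vanishing off `Λ_L^N` with `∫Ψ₀² = 1` and `e^{-λt} ≤ ⟨Ψ₀, e^{-tH_N}Ψ₀⟩` for all `t > 0`: for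
every `ε > 0` there is an admissible trial state `Ψ` with `⟨Ψ, H_N Ψ⟩ ≤ λ + ε` and
`sup_X |Ψ(X) − Ψ₀(X)| ≤ ε`. The construction is the tree's (`trialFn L θ Ψ₀`: dilation about the
centre by `θ ↓ 1`, mollification at radius `L(θ−1)/(4θ)`, normalisation), Chung–Zhao Prop 3.29
(upper half) in the variational vocabulary; the uniform closeness is `trialFn_tendsto_uniformly`
plus `|c − 1| ≤ 2|∫φ² − 1|` for the normalising constant `c = (∫φ²)^{-1/2}`.
[cite: ChungZhao1995, Thm 3.27 and Prop 3.29 (81)] -/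
theorem exists_trialState_near {L : ℝ} (hL : 0 < L) {v : ℝ → ℝ≥0∞} (hv : Measurable v)
    {C : ℝ≥0} (hC : ∀ r, v r ≤ C) {Ψ₀ : Config N → ℝ} (hcont : Continuous Ψ₀)
    (h0 : ∀ X, X ∉ boxN N L → Ψ₀ X = 0) (hnn : ∀ X, 0 ≤ Ψ₀ X)
    (hsymm : ∀ (σ : Equiv.Perm (Fin N)) (X : Config N), Ψ₀ (X ∘ σ) = Ψ₀ X)
    (hnorm : ∫ X, Ψ₀ X ^ 2 = 1) {lam : ℝ}
    (heig : ∀ t : ℝ, 0 < t → Real.exp (-(lam * t)) ≤ ∫ X, Ψ₀ X * fkReal v L t Ψ₀ X)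
    {ε : ℝ} (hε : 0 < ε) :
    ∃ Ψ : TrialState N L, energy v Ψ ≤ ENNReal.ofReal lam + ENNReal.ofReal ε ∧
      ∀ X, ‖Ψ.ψ X - (Ψ₀ X : ℂ)‖ ≤ ε := by
  -- data of `Ψ₀`
  have hcs : HasCompactSupport Ψ₀ :=
    HasCompactSupport.intro (isCompact_closedBall (0 : Config N) (3 * |L|))
      fun X hX => h0 X fun hb => hX (boxN_subset_closedBall N L hb)
  have hΨm : Measurable Ψ₀ := hcont.measurable
  obtain ⟨M0, hM0⟩ := hcs.exists_bound_of_continuous hcont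
  set M : ℝ := max M0 0 with hMdef
  have hMnn : 0 ≤ M := le_max_right _ _
  have hMabs : ∀ X, |Ψ₀ X| ≤ M := fun X => by
    have := hM0 X; rw [Real.norm_eq_abs] at this; exact this.trans (le_max_left _ _)
  have hΨsq : Integrable (fun X => Ψ₀ X ^ 2) volume := (hcont.memLp_of_hasCompactSupport hcs).integrable_sq
  set Pot : ℝ := ∫ X, Ψ₀ X ^ 2 * (interaction v X).toReal with hPotdef
  have hPot0 : 0 ≤ Pot := integral_nonneg fun X => mul_nonneg (sq_nonneg _) ENNReal.toReal_nonneg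
  -- `Pot ≤ λ` from the eventual bound on the (nonnegative) squared increments
  have hPotle : Pot ≤ lam := by
    by_contra hlt
    push Not at hlt
    have hev := sqIncr_toReal_eventually_le hv hC hcont h0 hnn hnorm heig (K' := (lam - Pot) / 2)
      (by rw [hPotdef] at hlt ⊢; linarith)
    obtain ⟨t, ht, htpos⟩ := (hev.and self_mem_nhdsWithin).exists
    have ht' : (0 : ℝ) < t := by exact_mod_cast htpos
    have h0le : 0 ≤ (sqIncr t Ψ₀).toReal := ENNReal.toReal_nonneg
    nlinarith
  have hlam0 : 0 ≤ lam := hPot0.trans hPotle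
  -- the bounded weight `V.toReal ≤ N²C`
  set CV : ℝ := ((N * N : ℕ) : ℝ) * C with hCVdef
  have hCV0 : 0 ≤ CV := by positivity
  have hVreal : ∀ X : Config N, |(interaction v X).toReal| ≤ CV := fun X => by
    rw [abs_of_nonneg ENNReal.toReal_nonneg]
    have h1 := interaction_le_of_le (C := (C : ℝ≥0∞)) (fun r => hC r) X
    have h2 : ((N * N : ℕ) : ℝ≥0∞) * (C : ℝ≥0∞) ≠ ⊤ :=
      ENNReal.mul_ne_top (ENNReal.natCast_ne_top _) ENNReal.coe_ne_top
    have := ENNReal.toReal_mono h2 h1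
    rw [ENNReal.toReal_mul] at this
    simpa [hCVdef] using this
  have hVnorm : ∀ X : Config N, ‖(interaction v X).toReal‖ ≤ CV := fun X => by
    rw [Real.norm_eq_abs]; exact hVreal X
  set vol : ℝ := (volume (boxN N L)).toReal with hvoldef
  have hvol0 : 0 ≤ vol := ENNReal.toReal_nonneg
  -- `ε`-management: `η ≤ ε/(8(M+1))`, `η ≤ 1/4`
  set η : ℝ := min (ε / (8 * (M + 1))) (1 / 4) with hηdef
  have hη : 0 < η := lt_min (div_pos hε (by positivity)) (by norm_num)
  have hηε : η ≤ ε / (8 * (M + 1)) := min_le_left _ _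
  have hη1 : η ≤ 1 / 4 := min_le_right _ _
  have hη4 : 4 * η ≤ ε := by
    have h1 : ε / (8 * (M + 1)) ≤ ε / 4 := by
      rw [div_le_div_iff₀ (by positivity) (by positivity)]; nlinarith
    linarith
  set K' : ℝ := lam - Pot + η with hK'def
  have hK' : lam - Pot < K' := by rw [hK'def]; linarith
  have hK'0 : 0 ≤ K' := by rw [hK'def]; linarith
  have hev := sqIncr_div_eventually_le hv hC hcont h0 hnn hnorm heig hK'
  set τ : ℝ := η / (lam + 4 * η + 1) with hτdef
  have hτ : 0 < τ := div_pos hη (by linarith)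
  have hτη : τ ≤ η := by
    rw [hτdef]
    exact div_le_self hη.le (by linarith)
  have hτlam : τ * (lam + 4 * η) ≤ η := by
    rw [hτdef, div_mul_eq_mul_div, div_le_iff₀ (by linarith)]
    exact mul_le_mul_of_nonneg_left (by linarith) hη.le
  set s : ℝ := τ / ((CV + 1) * (vol + 1) * (2 * M + 1)) with hsdef
  have hs : 0 < s := div_pos hτ (by positivity)
  have hsτ : s ≤ τ := by
    rw [hsdef]
    refine div_le_self hτ.le ?_
    have h1 : (1 : ℝ) ≤ CV + 1 := by linarith
    have h2 : (1 : ℝ) ≤ vol + 1 := by linarith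
    have h3 : (1 : ℝ) ≤ 2 * M + 1 := by linarith
    exact one_le_mul_of_one_le_of_one_le (one_le_mul_of_one_le_of_one_le h1 h2) h3
  have hsB : ∀ B : ℝ, 0 ≤ B → B ≤ CV + 1 → B * vol * (2 * M) * s ≤ τ := by
    intro B hB0 hB1
    have hden : 0 < (CV + 1) * (vol + 1) * (2 * M + 1) := by positivity
    have : B * vol * (2 * M) * s = τ * (B * vol * (2 * M) / ((CV + 1) * (vol + 1) * (2 * M + 1))) := by
      simp only [hsdef]; field_simp
    rw [this]
    calc τ * (B * vol * (2 * M) / ((CV + 1) * (vol + 1) * (2 * M + 1))) ≤ τ * 1 := by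
          refine mul_le_mul_of_nonneg_left ((div_le_one hden).2 ?_) hτ.le
          calc B * vol * (2 * M) ≤ (CV + 1) * vol * (2 * M) := by gcongr
            _ ≤ (CV + 1) * (vol + 1) * (2 * M + 1) := by gcongr <;> linarith
      _ = τ := mul_one τ
  -- choose `θ`
  have hunif := trialFn_tendsto_uniformly hL hcont h0 hs
  have hsq : ∀ᶠ θ : ℝ in 𝓝[>] 1, θ ^ 2 * K' ≤ K' + η := by
    have hc : Continuous fun θ : ℝ => θ ^ 2 * K' := by fun_prop
    have h1 : (fun θ : ℝ => θ ^ 2 * K') 1 < K' + η := by simp [hη]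
    exact ((hc.tendsto 1).eventually (gt_mem_nhds h1)).filter_mono nhdsWithin_le_nhds |>.mono
      fun θ hθ => hθ.le
  obtain ⟨θ, ⟨hu, hθsq⟩, hθ1⟩ := ((hunif.and hsq).and self_mem_nhdsWithin).exists
  have hθ1' : (1 : ℝ) < θ := hθ1
  -- the trial function at this `θ`
  set φ := trialFn L θ Ψ₀ with hφdef
  have hφC : ContDiff ℝ 1 φ := contDiff_trialFn hcont
  have hφm : Measurable φ := hφC.continuous.measurable
  have hφM : ∀ X, |φ X| ≤ M := abs_trialFn_le hMabs
  have hφ0 : ∀ X, X ∉ boxN N L → φ X = 0 := trialFn_eq_zero hL hθ1' h0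
  have hφsq : Integrable (fun X => φ X ^ 2) volume :=
    ((contDiff_trialFn hcont).continuous.memLp_of_hasCompactSupport
      (HasCompactSupport.intro (isCompact_closedBall (0 : Config N) (3 * |L|))
        fun X hX => hφ0 X fun hb => hX (boxN_subset_closedBall N L hb))).integrable_sq
  -- the norm and the potential energy are close to `1` and `Pot`
  have hn1 : |(∫ X, φ X ^ 2) - 1| ≤ τ := by
    have heq : (∫ X, φ X ^ 2) - 1 = ∫ X, (φ X ^ 2 - Ψ₀ X ^ 2) * (fun _ => (1 : ℝ)) X := by
      simp only [mul_one]
      rw [integral_sub hφsq hΨsq, hnorm]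
    rw [heq, ← Real.norm_eq_abs]
    refine (norm_integral_sq_sub_sq_mul_le (B := 1) hMnn hs.le hφM hMabs (fun _ => by norm_num)
      hφ0 h0 hu).trans ?_
    exact hsB 1 zero_le_one (by linarith)
  set PotV : ℝ := ∫ X, φ X ^ 2 * (interaction v X).toReal with hPotVdef
  have hPV : |PotV - Pot| ≤ τ := by
    have hint1 : Integrable (fun X => φ X ^ 2 * (interaction v X).toReal) volume := by
      refine (hφsq.mul_const CV).mono' ((hφm.pow_const 2).mul
        (measurable_interaction hv).ennreal_toReal).aestronglyMeasurable (Eventually.of_forall fun X => ?_)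
      rw [Real.norm_eq_abs, abs_mul, abs_of_nonneg (sq_nonneg _)]
      exact mul_le_mul_of_nonneg_left (hVreal X) (sq_nonneg _)
    have hint2 : Integrable (fun X => Ψ₀ X ^ 2 * (interaction v X).toReal) volume := by
      refine (hΨsq.mul_const CV).mono' ((hΨm.pow_const 2).mul
        (measurable_interaction hv).ennreal_toReal).aestronglyMeasurable (Eventually.of_forall fun X => ?_)
      rw [Real.norm_eq_abs, abs_mul, abs_of_nonneg (sq_nonneg _)]
      exact mul_le_mul_of_nonneg_left (hVreal X) (sq_nonneg _)
    have heq : PotV - Pot = ∫ X, (φ X ^ 2 - Ψ₀ X ^ 2) * (interaction v X).toReal := by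
      rw [hPotVdef, hPotdef, ← integral_sub hint1 hint2]
      refine integral_congr_ae (Eventually.of_forall fun X => ?_)
      ring
    rw [heq, ← Real.norm_eq_abs]
    refine (norm_integral_sq_sub_sq_mul_le hMnn hs.le hφM hMabs hVnorm hφ0 h0 hu).trans ?_
    exact hsB CV hCV0 (by linarith)
  -- positivity of the norm and the trial state
  have hn0 : 0 < ∫ X, φ X ^ 2 := by
    have := (abs_le.1 hn1).1; linarith
  set c : ℝ := (Real.sqrt (∫ X, φ X ^ 2))⁻¹ with hc
  have hc2 : c ^ 2 = (∫ X, φ X ^ 2)⁻¹ := by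
    rw [hc, inv_pow, Real.sq_sqrt hn0.le]
  have hnormΨ : ∫⁻ X, ((‖((c * φ X : ℝ) : ℂ)‖₊ : ℝ≥0∞)) ^ 2 = 1 := by
    have h1 : ∀ X, ((‖((c * φ X : ℝ) : ℂ)‖₊ : ℝ≥0∞)) ^ 2 =
        ENNReal.ofReal (c ^ 2) * ENNReal.ofReal (φ X ^ 2) := fun X => by
      rw [ennnorm_sq_ofReal_periodic, mul_pow, ENNReal.ofReal_mul (sq_nonneg _)]
    simp_rw [h1]
    rw [lintegral_const_mul' _ _ ENNReal.ofReal_ne_top,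
      ← ofReal_integral_eq_lintegral_ofReal hφsq (Eventually.of_forall fun X => sq_nonneg _),
      ← ENNReal.ofReal_mul (sq_nonneg _), hc2, inv_mul_cancel₀ hn0.ne', ENNReal.ofReal_one]
  let Ψ : TrialState N L :=
    { ψ := fun X => (((c * φ X : ℝ)) : ℂ)
      contDiff := Complex.ofRealCLM.contDiff.comp (contDiff_const.mul hφC)
      eq_zero := fun X hX => by simp [hφ0 X hX]
      symm := fun σ X => by
        show (((c * φ (X ∘ σ) : ℝ)) : ℂ) = (((c * φ X : ℝ)) : ℂ)
        rw [hφdef, trialFn_comp_perm hsymm σ X]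
      norm_eq := hnormΨ }
  -- the kinetic bound
  have hkin : ∫⁻ X, realKinetic φ X ≤ ENNReal.ofReal (K' + η) :=
    (lintegral_realKinetic_trialFn_le hθ1' hcont hMabs hev).trans (ENNReal.ofReal_le_ofReal hθsq)
  have hpotE : ∫⁻ X, ENNReal.ofReal (φ X ^ 2) * interaction v X = ENNReal.ofReal PotV := by
    have hVle : ∀ X : Config N, interaction v X ≤ ((N * N : ℕ) : ℝ≥0∞) * C := fun X =>
      interaction_le_of_le (C := (C : ℝ≥0∞)) (fun r => hC r) X
    have hVtop : ∀ X : Config N, interaction v X ≠ ⊤ := fun X =>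
      ne_top_of_le_ne_top (ENNReal.mul_ne_top (ENNReal.natCast_ne_top _) ENNReal.coe_ne_top) (hVle X)
    have hint1 : Integrable (fun X => φ X ^ 2 * (interaction v X).toReal) volume := by
      refine (hφsq.mul_const CV).mono' ((hφm.pow_const 2).mul
        (measurable_interaction hv).ennreal_toReal).aestronglyMeasurable (Eventually.of_forall fun X => ?_)
      rw [Real.norm_eq_abs, abs_mul, abs_of_nonneg (sq_nonneg _)]
      exact mul_le_mul_of_nonneg_left (hVreal X) (sq_nonneg _)
    rw [hPotVdef, ofReal_integral_eq_lintegral_ofReal hint1 (Eventually.of_forall fun X =>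
      mul_nonneg (sq_nonneg _) ENNReal.toReal_nonneg)]
    refine lintegral_congr fun X => ?_
    rw [ENNReal.ofReal_mul (sq_nonneg _), ENNReal.ofReal_toReal (hVtop X)]
  -- the energy of the real-scaled trial state: `𝓔[Ψ] = c² (∫|∇φ|² + ∫ φ² V)`
  have henergy : energy v Ψ = ENNReal.ofReal (c ^ 2) *
      ((∫⁻ X, realKinetic φ X) + ∫⁻ X, ENNReal.ofReal (φ X ^ 2) * interaction v X) := by
    have hφd : Differentiable ℝ φ := hφC.differentiable one_ne_zero
    have hcφd : Differentiable ℝ fun Y => c * φ Y := (differentiable_const c).mul hφd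
    have hkin : ∀ X, kineticDensity Ψ.ψ X = ENNReal.ofReal (c ^ 2) * realKinetic φ X := by
      intro X
      show kineticDensity (fun Y => (((c * φ Y : ℝ)) : ℂ)) X = _
      rw [kineticDensity_ofReal hcφd, realKinetic_const_mul_periodic hφd]
    have hnrm : ∀ X, ((‖Ψ.ψ X‖₊ : ℝ≥0∞)) ^ 2 = ENNReal.ofReal (c ^ 2) * ENNReal.ofReal (φ X ^ 2) := by
      intro X
      show ((‖(((c * φ X : ℝ)) : ℂ)‖₊ : ℝ≥0∞)) ^ 2 = _
      rw [ennnorm_sq_ofReal_periodic, mul_pow, ENNReal.ofReal_mul (sq_nonneg _)]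
    unfold energy
    simp_rw [hkin, hnrm]
    have h1 : ∀ X, ENNReal.ofReal (c ^ 2) * realKinetic φ X +
        interaction v X * (ENNReal.ofReal (c ^ 2) * ENNReal.ofReal (φ X ^ 2)) =
        ENNReal.ofReal (c ^ 2) * (realKinetic φ X + ENNReal.ofReal (φ X ^ 2) * interaction v X) := by
      intro X; ring
    simp_rw [h1]
    rw [lintegral_const_mul' _ _ ENNReal.ofReal_ne_top, lintegral_add_left (measurable_realKinetic hφC)]
  have hPotV0 : 0 ≤ PotV := integral_nonneg fun X => mul_nonneg (sq_nonneg _) ENNReal.toReal_nonneg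
  -- the energy bound in `[0, ∞]`
  have hE : energy v Ψ ≤ ENNReal.ofReal ((∫ X, φ X ^ 2)⁻¹ * (K' + η + PotV)) := by
    rw [henergy, hpotE, hc2,
      ENNReal.ofReal_mul (inv_nonneg.2 hn0.le), ENNReal.ofReal_add (by linarith) hPotV0]
    gcongr
  -- the real inequality
  have hreal : (∫ X, φ X ^ 2)⁻¹ * (K' + η + PotV) ≤ lam + ε := by
    set n := ∫ X, φ X ^ 2 with hndef
    have hn_low : 1 - τ ≤ n := by have := (abs_le.1 hn1).1; linarith
    have hPVle : PotV ≤ Pot + τ := by have := (abs_le.1 hPV).2; linarith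
    rw [inv_mul_le_iff₀ hn0]
    have h1 : K' + η + PotV ≤ lam + 3 * η := by rw [hK'def]; linarith
    have h2 : lam + 3 * η ≤ n * (lam + 4 * η) := by
      have h3 : (1 - τ) * (lam + 4 * η) ≤ n * (lam + 4 * η) :=
        mul_le_mul_of_nonneg_right hn_low (by linarith)
      linarith
    have h4 : n * (lam + 4 * η) ≤ n * (lam + ε) := mul_le_mul_of_nonneg_left (by linarith) hn0.le
    linarith
  refine ⟨Ψ, ?_, fun X => ?_⟩
  · calc energy v Ψ ≤ ENNReal.ofReal ((∫ X, φ X ^ 2)⁻¹ * (K' + η + PotV)) := hE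
      _ ≤ ENNReal.ofReal (lam + ε) := ENNReal.ofReal_le_ofReal hreal
      _ ≤ ENNReal.ofReal lam + ENNReal.ofReal ε := ENNReal.ofReal_add_le
  · -- uniform closeness: `|cφ − Ψ₀| ≤ |c − 1| M + s ≤ 2τM + τ ≤ ε`
    have hc1 : |c - 1| ≤ 2 * τ := abs_inv_sqrt_sub_one_le hn1 (hτη.trans hη1)
    have hdiff : |c * φ X - Ψ₀ X| ≤ 2 * τ * M + s := by
      calc |c * φ X - Ψ₀ X| = |(c - 1) * φ X + (φ X - Ψ₀ X)| := by ring_nf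
        _ ≤ |(c - 1) * φ X| + |φ X - Ψ₀ X| := abs_add_le _ _
        _ ≤ 2 * τ * M + s := by
            rw [abs_mul]
            exact add_le_add (mul_le_mul hc1 (hφM X) (abs_nonneg _) (by positivity)) (hu X)
    have hfin : 2 * τ * M + s ≤ ε := by
      have h1 : τ * (2 * M + 1) ≤ η * (2 * M + 1) := mul_le_mul_of_nonneg_right hτη (by linarith)
      have h2 : η * (2 * M + 1) ≤ ε / (8 * (M + 1)) * (2 * M + 1) :=
        mul_le_mul_of_nonneg_right hηε (by linarith)
      have h3 : ε / (8 * (M + 1)) * (2 * M + 1) ≤ ε :=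
        calc ε / (8 * (M + 1)) * (2 * M + 1) ≤ ε / (8 * (M + 1)) * (8 * (M + 1)) :=
              mul_le_mul_of_nonneg_left (by linarith) (div_nonneg hε.le (by positivity))
          _ = ε := div_mul_cancel₀ _ (by positivity)
      linarith
    have hnormeq : ‖Ψ.ψ X - (Ψ₀ X : ℂ)‖ = |c * φ X - Ψ₀ X| := by
      show ‖(((c * φ X : ℝ)) : ℂ) - (Ψ₀ X : ℂ)‖ = _
      rw [← Complex.ofReal_sub, Complex.norm_real, Real.norm_eq_abs]
    rw [hnormeq]
    exact hdiff.trans hfin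

end Summit.AtomisticToContinuum.BoseEinsteinCondensation.Theorems.BECInsertionVariance

end
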